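import Literature.NumberTheory.PAdicHodge.AinfRamifiedKummerIntegralEta
import Literature.NumberTheory.PAdicHodge.KummerFilZeroCoboundarySupersingular
import HarnessLib

/-!
# The Kummer cocycle of a RATIONAL formal point dies in `H¹(F, B_dR⁺ ⊗ V_pE)` — the RAMIFIED base `𝒪_D` (good model of an additive,
# potentially good curve over `F ⊇ F_D`), modulo the Hodge–Tate and η-transversality witnesses

Topic `Literature/NumberTheory/PAdicHodge`; namespace `Literature.NumberTheory.PAdicHodge`. THEOREMS ONLY (no definition, no named
fact, no `sorry`, no instance). The ramified twin of `KummerFilZeroCoboundaryRestricted` (brick K1 «Kummer classes die in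
`H¹(F, B_dR⁺ ⊗ V_pW)`» of the hT₂ programme of crux K★ stmt-BirchSwinnertonDyer-22226 — the currency of K★'s additive potentially-good
cells: `W` a Weierstrass equation over `CoeffDisc D = 𝒪_D = ℤ_p[ϖ]`, Tate module `TatePtO F (W ⊗_ψ 𝒪_F) p`, periods
`omegaPeriodHomO` / `etaPeriodHomO`, Kummer cocycle `kummerCocycleO` of `AinfRamifiedDivisionLift`, integrating pair
`AinfRamTop.bOmega` / `AinfRamTop.bEta` of `AinfRamifiedKummerIntegral(Eta)`), fed to the basis-free criterion
`isFilZeroCoboundary_restrictedRationalTateRep_of_periodHoms` (`KummerFilZeroCoboundaryCriterion`):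

* `isFilZeroCoboundary_kummerCocycleO_restricted_of_matching` — for `W₀` elliptic over `K₀ ⊆ F` with an equivariant `ℤ_p`-matching
  `e : T_pW₀ ≃ TatePtO F (W ⊗_ψ 𝒪_F) p`, witnesses (HT) `∃ τ, ∫_τ ω ∉ (Fil¹)²` and (Nη) `∃ τ, R_p(τ₁) ∉ p𝒪_{ℂ_F}`, and a `[p]_W`-division
  sequence `u` with a `Γ_F`-fixed lift `Q ∈ Ŵ(𝔫_𝒪)` of `u₀`: `σ ↦ 1 ⊗ e⁻¹(κ_u σ)` is a `Fil⁰`-coboundary of `B_dR(F) ⊗ V_pW₀|_{Γ_F}`;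
* `isFilZeroCoboundary_kummerCocycleO_restricted_of_matching_of_coeffDisc` — the same for `𝒪_D`-RATIONAL base points (parameter
  `c ∈ 𝔪_D`; the fixed lift is `AinfRamTop.coeffPt c`).
(HT) over the ramified base is NOT discharged here (the tree's Hodge–Tate nonvanishing `AinfTop.exists_omegaPeriodHom_not_mem_filOne_sq`
is the unramified good-supersingular case); (Nη) is supplied on K★'s cells by `AinfRamifiedEtaTransversalityCells`. BSD / K★ are not
proved by any of this.

References: [BlochKato1990] Ex. 3.10.1, (3.11.1), Lemma 3.8.1; [Kato1993LNM1553] Ch. II Lemma 1.4.3; [Fontaine1982FormesDifferentielles]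
§5; [Colmez1992PeriodesAbeliennes] §2; [FontaineAsterisque223III] Exp. II §1.5.
-/

noncomputable section

open scoped TensorProduct

namespace Literature.NumberTheory.PAdicHodge

open Literature Literature.NumberTheory.GaloisRepresentations Literature.NumberTheory.EllipticCurves WeierstrassCurve
open Literature.NumberTheory.GaloisRepresentations.IsNonarchimedeanLocalField Field ValuativeRel
open Literature.NumberTheory.GaloisRepresentations.LubinTate

variable {F : Type} [Field F] [ValuativeRel F] [TopologicalSpace F] [IsNonarchimedeanLocalField F] [CharZero F]
  {p : ℕ} [Fact p.Prime] [Fact (¬ IsUnit (p : integerC F))] [IsAdicComplete (Ideal.span {(p : integerC F)}) (integerC F)]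
  (hp : valuation F p < 1) [Algebra ℚ_[p] F]

/-- **K1 over the ramified base, in the (S5a) currency, witness form.** `W` over `𝒪_D`, `ψ : 𝒪_D → 𝒪_F` the coefficient map;
`W₀` elliptic over `K₀ ⊆ F` with an equivariant `ℤ_p`-matching `e : T_pW₀ ≃ T_pŴ♭(𝒪_{ℂ_F})`; witnesses (HT) `∃ τ, ∫_τ ω ∉ (Fil¹)²` and
(Nη) `∃ τ, R_p(τ₁) ∉ p𝒪_{ℂ_F}`; `u` a `[p]_W`-division sequence with a `Γ_F`-fixed lift `Q ∈ Ŵ(𝔫_𝒪)` of `u₀`. Then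
`σ ↦ 1 ⊗ e⁻¹(κ_u σ)` is a `Fil⁰`-coboundary of `B_dR(F) ⊗ V_pW₀|_{Γ_F}`. [cite: BlochKato1990, Ex. 3.10.1, (3.11.1), Lemma 3.8.1]
[cite: Kato1993LNM1553, Ch. II Lemma 1.4.3] -/
theorem isFilZeroCoboundary_kummerCocycleO_restricted_of_matching (D : EisensteinRoot F p hp)
    (W : WeierstrassCurve (EisensteinRoot.CoeffDisc D)) (ψ : EisensteinRoot.CoeffDisc D →+* LTCoeff F)
    (hψ : ∀ c, algebraMap (LTCoeff F) F (ψ c) = EisensteinRoot.CoeffDisc.toF D c)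
    {K₀ : Type} [Field K₀] [CharZero K₀] (W₀ : WeierstrassCurve K₀) [W₀.IsElliptic] [Algebra K₀ F]
    (e : W₀.tateModule p ≃ₗ[ℤ_[p]] AinfTop.TatePtO F (W.map ψ) p)
    (he : ∀ (σ : absoluteGaloisGroup F) (a : W₀.tateModule p), e (absGaloisRestrict K₀ F σ • a) = σ • e a)
    (hHT : ∃ τ : AinfTop.TatePtO F (W.map ψ) p, AinfRamTop.omegaPeriodHomO W ψ (surjective_fontaineTheta_integerC hp) hψ τ ∉
      ((BdRPlusTop.filOne F p).toIdeal ^ 2 : Ideal (BdRPlusTop F p)))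
    (hNη : ∃ τ : AinfTop.TatePtO F (W.map ψ) p,
      AinfRamTop.mulDefectC (surjective_fontaineTheta_integerC hp) W (AinfTop.seqO (W.map ψ) τ 1) ∉ Ideal.span {(p : CBall F)})
    {u : ℕ → (maxNilIdealC F).toIdeal} (hup : ∀ n, AinfRamTop.mulPC W (u (n + 1)) = u n)
    {Q : W.Pt (AinfRamTop.nilTheta D (surjective_fontaineTheta_integerC hp))}
    (hQ : AinfRamTop.thetaPt W (surjective_fontaineTheta_integerC hp) Q = ⟨u 0⟩)
    (hQσ : ∀ σ : absoluteGaloisGroup F, AinfRamTop.galPtN W (surjective_fontaineTheta_integerC hp) σ Q = Q) :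
    (bdRPeriodRingData (F := F) (p := p) hp).IsFilZeroCoboundary (restrictedRationalTateRep W₀ F p) fun σ =>
      ((1 : (bdRPeriodRingData (F := F) (p := p) hp).B) ⊗ₜ[ℚ_[p]]
        TateModule.toRational p (e.symm (AinfRamTop.kummerCocycleO W ψ hψ u hup
          (AinfRamTop.galCBall_base_eq_of_fixedLift W hQ hQσ) σ)) :
        (bdRPeriodRingData (F := F) (p := p) hp).B ⊗[ℚ_[p]] W₀.rationalTateModule p) := by
  have hF := surjective_fontaineTheta_integerC hp
  -- rigidity of the `ℚ_p`-algebra structure of `F`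
  have halg : ∀ c : ℚ_[p], algebraMap ℚ_[p] F c = LocalField.padicRingHom F p hp c := fun c =>
    RingHom.congr_fun (LocalField.ringHom_padic_ext _ _) c
  -- the bridge `B_dR⁺ → B_dR` and the two period functionals on `T_pW₀`
  let ιB : BdRPlusTop F p →+* (bdRPeriodRingData (F := F) (p := p) hp).B :=
    (algebraMap (BDeRhamPlus (integerC F) p) (FracBdR F p)).comp (BdRPlusTop.of F p).symm.toRingHom
  have hιB : ∀ y, ιB y = algebraMap (BDeRhamPlus (integerC F) p) (FracBdR F p) ((BdRPlusTop.of F p).symm y) :=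
    fun _ => rfl
  let φ₁ : W₀.tateModule p →+ (bdRPeriodRingData (F := F) (p := p) hp).B :=
    ιB.toAddMonoidHom.comp ((AinfRamTop.omegaPeriodHomO W ψ hF hψ).comp e.toAddMonoidHom)
  let φ₂ : W₀.tateModule p →+ (bdRPeriodRingData (F := F) (p := p) hp).B :=
    ιB.toAddMonoidHom.comp ((AinfRamTop.etaPeriodHomO W ψ hF hψ).comp e.toAddMonoidHom)
  have hφ₁ : ∀ a, φ₁ a = ιB (AinfRamTop.omegaPeriodHomO W ψ hF hψ (e a)) := fun _ => rfl
  have hφ₂ : ∀ a, φ₂ a = ιB (AinfRamTop.etaPeriodHomO W ψ hF hψ (e a)) := fun _ => rfl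
  have hsc : ∀ (c : ℤ_[p]) (y : BdRPlusTop F p),
      ιB (BdRPlusTop.of F p (qpToBdR (c : ℚ_[p])) * y) = (c : ℚ_[p]) • ιB y := fun c y => by
    rw [map_mul, Algebra.smul_def, PeriodRingData.algebraMap_eq]
    congr 1
    change algebraMap (BDeRhamPlus (integerC F) p) (FracBdR F p) (qpToBdR (c : ℚ_[p])) =
      algebraMap (BDeRhamPlus (integerC F) p) (FracBdR F p) (embBdRHom hp hF (algebraMap ℚ_[p] F c))
    rw [embBdRHom_algebraMap_padic hp hF halg]
  have hgal : ∀ (σ : absoluteGaloisGroup F) (y : BdRPlusTop F p), ιB (BdRPlusTop.gal F p σ y) = σ • ιB y := fun σ y => by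
    change _ = σ • algebraMap (BDeRhamPlus (integerC F) p) (FracBdR F p) ((BdRPlusTop.of F p).symm y)
    rw [smul_algebraMap_fracBdR]
    rfl
  -- the integrating pair
  have hu₀ := AinfRamTop.galCBall_base_eq_of_fixedLift W hQ hQσ
  have hω : ∀ σ, BdRPlusTop.gal F p σ (AinfRamTop.bOmega W hup hQ) - AinfRamTop.bOmega W hup hQ =
      AinfRamTop.omegaPeriodHomO W ψ hF hψ (AinfRamTop.kummerCocycleO W ψ hψ u hup hu₀ σ) :=
    AinfRamTop.gal_bOmega_sub_bOmega_eq_omegaPeriodHomO W ψ hup hQ hQσ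
  have hη : ∀ σ, BdRPlusTop.gal F p σ (AinfRamTop.bEta W hup hQ) - AinfRamTop.bEta W hup hQ =
      AinfRamTop.etaPeriodHomO W ψ hF hψ (AinfRamTop.kummerCocycleO W ψ hψ u hup hu₀ σ) :=
    AinfRamTop.gal_bEta_sub_bEta_eq_etaPeriodHomO W ψ hup hQ hQσ
  refine isFilZeroCoboundary_restrictedRationalTateRep_of_periodHoms hp W₀ φ₁ φ₂ (fun c a => ?_) (fun c a => ?_)
    (fun σ a => ?_) (fun σ a => ?_) (fun a => ?_) (fun a => ?_) ?_ ?_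
    (fun σ => e.symm (AinfRamTop.kummerCocycleO W ψ hψ u hup hu₀ σ)) (b₁ := ιB (AinfRamTop.bOmega W hup hQ))
    (b₂ := ιB (AinfRamTop.bEta W hup hQ)) ?_ ?_ (fun σ => ?_) (fun σ => ?_)
  · rw [hφ₁, hφ₁, LinearEquiv.map_smul, AinfRamTop.omegaPeriodHomO_smul', hsc]
  · rw [hφ₂, hφ₂, LinearEquiv.map_smul, AinfRamTop.etaPeriodHomO_smul', hsc]
  · rw [hφ₁, hφ₁, he, ← AinfRamTop.gal_omegaPeriodHomO, hgal]
  · rw [hφ₂, hφ₂, he, ← AinfRamTop.gal_etaPeriodHomO, hgal]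
  · rw [hφ₁, hιB]
    exact (algebraMap_mem_fil_one_iff hp _).2 (AinfRamTop.omegaPeriodHomO_mem_filOne W ψ _)
  · rw [hφ₂, hιB]
    haveI : IsDomain (BDeRhamPlus (integerC F) p) := isDomain_bDeRhamPlus hF
    letI : Algebra F (FracBdR F p) := fracAlgebra hp hF
    exact algebraMap_mem_fil_zero hp hF _
  · obtain ⟨τ, hτ⟩ := hHT
    refine ⟨e.symm τ, fun h => hτ ?_⟩
    rw [hφ₁, LinearEquiv.apply_symm_apply, hιB] at h
    exact mem_sq_of_algebraMap_mem_fil_two hp _ h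
  · obtain ⟨τ, hτ⟩ := hNη
    refine ⟨e.symm τ, fun h => AinfRamTop.etaPeriodHomO_not_mem_filOne W ψ (hθ := hF) (hψ := hψ) τ hτ
      ((algebraMap_mem_fil_one_iff hp (AinfRamTop.etaPeriodHomO W ψ hF hψ τ)).1 ?_)⟩
    rwa [hφ₂, LinearEquiv.apply_symm_apply, hιB] at h
  · rw [hιB]
    exact (algebraMap_mem_fil_one_iff hp _).2 (AinfRamTop.bOmega_mem_filOne W hup hQ)
  · rw [hιB]
    haveI : IsDomain (BDeRhamPlus (integerC F) p) := isDomain_bDeRhamPlus hF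
    letI : Algebra F (FracBdR F p) := fracAlgebra hp hF
    exact algebraMap_mem_fil_zero hp hF _
  · rw [hφ₁, LinearEquiv.apply_symm_apply, ← hω σ, map_sub, hgal]
  · rw [hφ₂, LinearEquiv.apply_symm_apply, ← hη σ, map_sub, hgal]

/-- **K1 over the ramified base for `𝒪_D`-RATIONAL base points** (parameter `c ∈ 𝔪_D`): with the equivariant matching `e`, the
witnesses (HT), (Nη), and a `[p]_W`-division sequence `u` of the `𝒪_D`-rational point with parameter `c`, the Kummer cocycle dies in
`H¹(F, B_dR⁺ ⊗ V_pW₀|_{Γ_F})`. [cite: BlochKato1990, Ex. 3.10.1, (3.11.1), Lemma 3.8.1] [cite: Kato1993LNM1553, Ch. II Lemma 1.4.3] -/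
theorem isFilZeroCoboundary_kummerCocycleO_restricted_of_matching_of_coeffDisc (D : EisensteinRoot F p hp)
    (W : WeierstrassCurve (EisensteinRoot.CoeffDisc D)) (ψ : EisensteinRoot.CoeffDisc D →+* LTCoeff F)
    (hψ : ∀ c, algebraMap (LTCoeff F) F (ψ c) = EisensteinRoot.CoeffDisc.toF D c)
    {K₀ : Type} [Field K₀] [CharZero K₀] (W₀ : WeierstrassCurve K₀) [W₀.IsElliptic] [Algebra K₀ F]
    (e : W₀.tateModule p ≃ₗ[ℤ_[p]] AinfTop.TatePtO F (W.map ψ) p)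
    (he : ∀ (σ : absoluteGaloisGroup F) (a : W₀.tateModule p), e (absGaloisRestrict K₀ F σ • a) = σ • e a)
    (hHT : ∃ τ : AinfTop.TatePtO F (W.map ψ) p, AinfRamTop.omegaPeriodHomO W ψ (surjective_fontaineTheta_integerC hp) hψ τ ∉
      ((BdRPlusTop.filOne F p).toIdeal ^ 2 : Ideal (BdRPlusTop F p)))
    (hNη : ∃ τ : AinfTop.TatePtO F (W.map ψ) p,
      AinfRamTop.mulDefectC (surjective_fontaineTheta_integerC hp) W (AinfTop.seqO (W.map ψ) τ 1) ∉ Ideal.span {(p : CBall F)})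
    {u : ℕ → (maxNilIdealC F).toIdeal} (hup : ∀ n, AinfRamTop.mulPC W (u (n + 1)) = u n) (c : EisensteinRoot.CoeffDisc D)
    (hc : ‖algebraMap F (CompletedAlgClosure F) (EisensteinRoot.CoeffDisc.toF D c)‖ < 1)
    (hu0 : (u 0 : CBall F) = algebraMap (EisensteinRoot.CoeffDisc D) (CBall F) c) :
    ∃ hu₀ : ∀ σ : absoluteGaloisGroup F, galCBall σ (u 0 : CBall F) = u 0,
      (bdRPeriodRingData (F := F) (p := p) hp).IsFilZeroCoboundary (restrictedRationalTateRep W₀ F p) fun σ =>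
        ((1 : (bdRPeriodRingData (F := F) (p := p) hp).B) ⊗ₜ[ℚ_[p]]
          TateModule.toRational p (e.symm (AinfRamTop.kummerCocycleO W ψ hψ u hup hu₀ σ)) :
          (bdRPeriodRingData (F := F) (p := p) hp).B ⊗[ℚ_[p]] W₀.rationalTateModule p) := by
  have hQ : AinfRamTop.thetaPt W (surjective_fontaineTheta_integerC hp) (AinfRamTop.coeffPt W (surjective_fontaineTheta_integerC hp) c hc)
      = ⟨u 0⟩ :=
    WeierstrassCurve.Pt.ext (Subtype.ext (by rw [AinfRamTop.coe_val_thetaPt_coeffPt, hu0]))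
  exact ⟨AinfRamTop.galCBall_base_eq_of_fixedLift W hQ fun σ => AinfRamTop.galPtN_coeffPt W σ c hc,
    isFilZeroCoboundary_kummerCocycleO_restricted_of_matching hp D W ψ hψ W₀ e he hHT hNη hup hQ
      fun σ => AinfRamTop.galPtN_coeffPt W σ c hc⟩

end Literature.NumberTheory.PAdicHodge

end
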